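import Literature.MathematicalPhysics.QuantumFieldTheory.Balaban1983to89.B10Eq69Local
import HarnessLib

/-!
# `AlphaInputsT3ACv3SmallFactor71Sym` — (69)_sym PIECE (v), THE CURRENCY-FREE CORE OF [Balaban1985UV3] (70)–(71): the per-plaquette small factor `¼p(g_j)²` from ANY
# large quantity `v ≥ g_jp(g_j)` obeying the rigid-sum bound (69) `v < Σ_{x∈B^j(x₀)} L^{−3j} Σ_{p⊂(p′)_x} |U_k(∂p) − 1| + b`, `b ≤ C₂(g_jp)²`, and (68) on `Δ′` — so that the
# SYMMETRIC-currency largeness of the R3 tower (`large67RecSet`, ★★OWNER RULING g26-№8 (1)(α) ∕ №13 (ii) R-ii) feeds (71) once (69)_sym (★w6-19936 g2 pieces (i)–(iv)) supplies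
# `h69` for `v := dist1((blockAvg ℰp)^j U)(∂p′)` — cell `ym3-torus`, crux stmt-QuantumFields-19936 (`HistoryTailL`, (O″χ) B1 seam), LEAD seat `ym-ust-19936-w1` (g3)

WHAT (def-free).  §1 `smallFactor_of_large69` — LQB's ✓`B10Eq70Squaring.smallFactor_of_largeField` with the pair «(67) `Ū^j(∂p′) = V_j(∂p′)` ∧ `|V_j(∂p′) − 1| ≥ g_jp`» replaced by an
ABSTRACT large quantity `v` (`g_jp ≤ v`, (69) for `v`): the proof reads `v` only through these two facts (`ineq70_d3` + `ineq71`), so the comb average `avgIter` disappears from the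
hypotheses.  §2 `smallFactor_of_large69_unitary` — the `U(N)`-valued reading with the (11)-comparison and (68)-on-the-sub-plaquettes DISCHARGED exactly as in
✓`B10Eq69Local.smallFactor_of_largeField_concrete` (`dev_sq_le_two_act_unitary`, `plaqIn_translate`, `le_pdevOn`), `C₂` abstract; `exp_localized_le_large69_unitary`.
USE.  R-ii's seam row of record (71)_sym per recorded plaquette = §2 at `v := dist1 (plaqHol ((blockAvg ℰp)^j Ũ) p′)` (recording currency, `large67RecSet` gives `hv`), `h69` from
(69)_sym, `h68` from `reg68LocalSet`; the T³ knit to the `h71`-row shape of `…v3SmallFactor` (`regionT`, `liftCfg`, `γ₇₁`) follows ★alpha-1 g3's `eq71_perPlaquette_of_alphaV3`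
verbatim and is filed when (69)_sym's statement is frozen (LEAD).
HONEST FRAMING.  Elementary re-packaging of landed LQB theorems; (69)_sym itself is NOT proved here (hypothesis `h69`); the stub 2′χ, the crux and any gap are NOT claimed;
count-neutral helper (`--supports stmt-QuantumFields-19936`).  YM₃ on the three-torus is rung R3 of the programme, NOT the Clay problem: nothing here bears on d = 4,
infinite volume, or a mass gap.

References: T. Bałaban, Commun. Math. Phys. 102 (1985) 255–275 [Balaban1985UV3] ((67)–(71) p.273); Commun. Math. Phys. 98 (1985) 17–51 [Balaban1985Averaging] (Prop 2 (52)–(54) p.26).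
-/

set_option autoImplicit false

noncomputable section

namespace Summit.QuantumFields.YangMills.Theorems.SmallFactor71Sym

open scoped BigOperators Matrix.Norms.L2Operator
open Finset
open Literature.MathematicalPhysics.QuantumFieldTheory.Balaban1983to89
open Literature.MathematicalPhysics.QuantumFieldTheory.Balaban1983to89.B10Eq70Squaring
open Literature.MathematicalPhysics.QuantumFieldTheory.Balaban1983to89.B10Eq69Local (plaqIn_translate)
open B7Prop1Explicit (Site hol plaqWord e boxVec U1)
open B7Prop1Local (pdevOn loK plaqHiK PlaqIn le_pdevOn)
open B7Prop2Explicit (C0 C0_pos c2' unitaryUnits unitaryUnits_le_U1)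

/-! ## §1 The currency-free core: (70)–(71) from a large quantity obeying (69) -/

section Abstract

variable {𝔸 : Type*} [NormedRing 𝔸]

/-- **(70)–(71) FROM AN ABSTRACT LARGE QUANTITY** (`d = 3`): if `g_jp ≤ v` (largeness, any currency) and `v < Σ_x L^{−3j}Σ_{p⊂(p′)_x}|U(∂p) − 1| + b` ((69) for `v`), `0 ≤ b ≤ C₂(g_jp)²`,
(68) `|U(∂p) − 1| ≤ C₁g_jp·L^{−2j}` on the sub-plaquettes, `|U(∂p) − 1|² ≤ 2·act(p)` on `Δ′`, `g_k² = g_j²L^{k−j}`, `g_jp ≤ 1`, `½(2C₁C₂ + C₂²)g_jp ≤ ¼`, then the part of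
`(1/g_k²)A^η(U)` localized in `Δ′` is `≥ ¼p²`.  (✓`smallFactor_of_largeField` with (67) abstracted away.) [cite: Balaban1985UV3, (69)–(71) p.273] -/
theorem smallFactor_of_large69 (L : ℕ) (hL : 1 ≤ L) (j k : ℕ) (hjk : j ≤ k) (U : Site 3 → Fin 3 → 𝔸ˣ) (z₀ : Site 3) {μ ν : Fin 3} (hμν : μ ≠ ν)
    (act : Site 3 → ℝ) (hact : ∀ y ∈ deltaBox (L ^ j) ((L ^ j : ℕ) • z₀) μ ν, dev U μ ν y ^ 2 ≤ 2 * act y)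
    {gj gk p b C₁ C₂ v : ℝ} (hgj : 0 < gj) (hgk : gk ^ 2 = gj ^ 2 * (L : ℝ) ^ (k - j)) (hp : 0 ≤ p) (hgp : gj * p ≤ 1)
    (hv : gj * p ≤ v)
    (h68 : ∀ t : Idx 3 (L ^ j), dev U μ ν (corner (L ^ j) ((L ^ j : ℕ) • z₀) μ ν t) ≤ C₁ * (gj * p) / ((L : ℝ) ^ j) ^ 2)
    (h69 : v < blockSum (L ^ j) ((L ^ j : ℕ) • z₀) μ ν (dev U μ ν) + b) (hb : 0 ≤ b) (hbB : b ≤ C₂ * (gj * p) ^ 2)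
    (hsmall : (2 * C₁ * C₂ + C₂ ^ 2) / 2 * gj * p ≤ 1 / 4) :
    p ^ 2 / 4 ≤ (gk ^ 2)⁻¹ * ((L : ℝ) ^ k * ∑ y ∈ deltaBox (L ^ j) ((L ^ j : ℕ) • z₀) μ ν, act y) := by
  set x₀ : Site 3 := (L ^ j : ℕ) • z₀ with hx₀
  have hv0 : 0 ≤ v := le_trans (by positivity) hv
  -- (70), line 2, with A = C₁ g_j p, B = C₂ (g_j p)²
  have h70 := (ineq70_d3 L j hL x₀ μ ν hμν (F := dev U μ ν) (act := act) (fun y => dev_nonneg U μ ν y) hact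
    hv0 h69 hb hbB (A := C₁ * (gj * p)) (by intro t; rw [mul_div_assoc] at *; exact h68 t)).2
  -- the cross terms: 2AB + B² ≤ (2C₁C₂ + C₂²)(g_j p)³ for g_j p ≤ 1
  have hε0 : 0 ≤ gj * p := by positivity
  have hC2 : 0 ≤ C₂ * (gj * p) ^ 2 := hb.trans hbB
  have hcross : 2 * (C₁ * (gj * p)) * (C₂ * (gj * p) ^ 2) + (C₂ * (gj * p) ^ 2) ^ 2 ≤
      (2 * C₁ * C₂ + C₂ ^ 2) * (gj * p) ^ 3 := by
    have h4 : (gj * p) ^ 4 ≤ (gj * p) ^ 3 := by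
      calc (gj * p) ^ 4 = (gj * p) ^ 3 * (gj * p) := by ring
        _ ≤ (gj * p) ^ 3 * 1 := mul_le_mul_of_nonneg_left hgp (by positivity)
        _ = (gj * p) ^ 3 := by ring
    have hC22 : 0 ≤ C₂ ^ 2 := sq_nonneg _
    nlinarith [mul_le_mul_of_nonneg_left h4 hC22]
  have h70' : v ^ 2 ≤ 2 * (L : ℝ) ^ j * (∑ y ∈ deltaBox (L ^ j) x₀ μ ν, act y) +
      (2 * C₁ * C₂ + C₂ ^ 2) * (gj * p) ^ 3 := by linarith
  have hLpos : (0 : ℝ) < L := by exact_mod_cast (by omega : 0 < L)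
  exact ineq71 hLpos hjk hgj hgk hp hv h70' hsmall

end Abstract

/-! ## §2 The `U(N)`-valued reading: (11)-comparison and (68)-on-the-sub-plaquettes discharged -/

section Unitary

variable {N : ℕ} [NeZero N]

/-- **(70)–(71) FROM AN ABSTRACT LARGE QUANTITY, `U(N)` UNITS** (`d = 3`; `C₂` abstract): for a `U(N)`-valued fine configuration `U` with (68) `pdevOn (loK L j z₀) (plaqHiK L j z₀ μ ν) U <
C₁g_jp·L^{−2j}` on `Δ′`, any `v` with `g_jp ≤ v` and (69) `v < blockSum … (dev U μ ν) + b`, `0 ≤ b ≤ C₂(g_jp)²`, `g_k² = g_j²L^{k−j}`, `g_jp ≤ 1` and `½(2C₁C₂ + C₂²)g_jp ≤ ¼`: the part of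
`(1/g_k²)A^η(U)` localized in `Δ′`, `act(p) = N(1 − Re tr U(∂p))`, is `≥ ¼p²` — the R-ii seam row's core (take `v := dist1((blockAvg ℰp)^jŨ)(∂p′)`).
[cite: Balaban1985UV3, (68)–(71) p.273] -/
theorem smallFactor_of_large69_unitary (L : ℕ) (hL : 2 ≤ L) (j k : ℕ) (hjk : j ≤ k) (U : Site 3 → Fin 3 → (Matrix (Fin N) (Fin N) ℂ)ˣ)
    (hU : ∀ x κ, U x κ ∈ unitaryUnits (Matrix (Fin N) (Fin N) ℂ)) (z₀ : Site 3) {μ ν : Fin 3} (hμν : μ ≠ ν)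
    {gj gk p b C₁ C₂ v : ℝ} (hgj : 0 < gj) (hgk : gk ^ 2 = gj ^ 2 * (L : ℝ) ^ (k - j)) (hp : 0 ≤ p) (hgp : gj * p ≤ 1)
    (hv : gj * p ≤ v)
    (h68 : pdevOn (loK L j z₀) (plaqHiK L j z₀ μ ν) U < C₁ * (gj * p) * (((L : ℝ) ^ j)⁻¹) ^ 2)
    (h69 : v < blockSum (L ^ j) ((L ^ j : ℕ) • z₀) μ ν (dev U μ ν) + b) (hb : 0 ≤ b) (hbB : b ≤ C₂ * (gj * p) ^ 2)
    (hsmall : (2 * C₁ * C₂ + C₂ ^ 2) / 2 * gj * p ≤ 1 / 4) :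
    p ^ 2 / 4 ≤ (gk ^ 2)⁻¹ * ((L : ℝ) ^ k * ∑ y ∈ deltaBox (L ^ j) ((L ^ j : ℕ) • z₀) μ ν,
      (N : ℝ) * (1 - (N : ℝ)⁻¹ *
        (((hol U y (plaqWord μ ν) : (Matrix (Fin N) (Fin N) ℂ)ˣ) : Matrix (Fin N) (Fin N) ℂ).trace.re))) := by
  letI : CStarAlgebra (Matrix (Fin N) (Fin N) ℂ) := {}
  have hL1 : 1 ≤ L := le_trans (by norm_num) hL
  have hUU : ∀ x κ, U x κ ∈ U1 (Matrix (Fin N) (Fin N) ℂ) := fun x κ => unitaryUnits_le_U1 (hU x κ)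
  -- (68) on the sub-plaquettes `p ⊂ (p′)_x` (they lie in `Δ′`)
  have hz : ((L ^ j : ℕ) • z₀ : Site 3) = ((L ^ j : ℕ) : ℤ) • z₀ := by
    funext κ; simp [Pi.smul_apply]
  have h68' : ∀ t : Idx 3 (L ^ j), dev U μ ν (corner (L ^ j) ((L ^ j : ℕ) • z₀) μ ν t) ≤
      C₁ * (gj * p) / ((L : ℝ) ^ j) ^ 2 := by
    intro t
    have hmem := plaqIn_translate L j z₀ hμν t.1 t.2.1.isLt t.2.2.isLt
    have hle := le_pdevOn (lo := loK L j z₀) (hi := plaqHiK L j z₀ μ ν) hUU hmem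
    have hα₀' : C₁ * (gj * p) * (((L : ℝ) ^ j)⁻¹) ^ 2 = C₁ * (gj * p) / ((L : ℝ) ^ j) ^ 2 := by
      rw [inv_pow, div_eq_mul_inv]
    unfold dev corner
    rw [hz, ← hα₀']
    exact hle.trans h68.le
  exact smallFactor_of_large69 L hL1 j k hjk U z₀ hμν _ (fun y _ => dev_sq_le_two_act_unitary U hU μ ν y) hgj hgk hp hgp hv h68' h69 hb
    hbB hsmall

/-- **The small factor**: under the hypotheses of `smallFactor_of_large69_unitary`, `exp[−(1/g_k²)Σ_{p⊂Δ′}η⁻¹act(p)] ≤ exp(−¼p²)`. [cite: Balaban1985UV3, (71) p.273] -/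
theorem exp_localized_le_large69_unitary (L : ℕ) (hL : 2 ≤ L) (j k : ℕ) (hjk : j ≤ k) (U : Site 3 → Fin 3 → (Matrix (Fin N) (Fin N) ℂ)ˣ)
    (hU : ∀ x κ, U x κ ∈ unitaryUnits (Matrix (Fin N) (Fin N) ℂ)) (z₀ : Site 3) {μ ν : Fin 3} (hμν : μ ≠ ν)
    {gj gk p b C₁ C₂ v : ℝ} (hgj : 0 < gj) (hgk : gk ^ 2 = gj ^ 2 * (L : ℝ) ^ (k - j)) (hp : 0 ≤ p) (hgp : gj * p ≤ 1)
    (hv : gj * p ≤ v)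
    (h68 : pdevOn (loK L j z₀) (plaqHiK L j z₀ μ ν) U < C₁ * (gj * p) * (((L : ℝ) ^ j)⁻¹) ^ 2)
    (h69 : v < blockSum (L ^ j) ((L ^ j : ℕ) • z₀) μ ν (dev U μ ν) + b) (hb : 0 ≤ b) (hbB : b ≤ C₂ * (gj * p) ^ 2)
    (hsmall : (2 * C₁ * C₂ + C₂ ^ 2) / 2 * gj * p ≤ 1 / 4) :
    Real.exp (-((gk ^ 2)⁻¹ * ((L : ℝ) ^ k * ∑ y ∈ deltaBox (L ^ j) ((L ^ j : ℕ) • z₀) μ ν,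
      (N : ℝ) * (1 - (N : ℝ)⁻¹ *
        (((hol U y (plaqWord μ ν) : (Matrix (Fin N) (Fin N) ℂ)ˣ) : Matrix (Fin N) (Fin N) ℂ).trace.re))))) ≤
      Real.exp (-(p ^ 2 / 4)) := by
  have h := smallFactor_of_large69_unitary L hL j k hjk U hU z₀ hμν hgj hgk hp hgp hv h68 h69 hb hbB hsmall
  exact Real.exp_le_exp.mpr (by linarith)

end Unitary

end Summit.QuantumFields.YangMills.Theorems.SmallFactor71Sym

end
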